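import Mathlib.Algebra.BigOperators.Ring.Finset
import Mathlib.Algebra.Order.BigOperators.Group.Finset
import Mathlib.Data.Finset.Powerset
import Mathlib.Data.Finset.SymmDiff
import Mathlib.Data.Fintype.Basic
import Mathlib.Tactic
import HarnessLib

/-!
# Rivasseau's digraph lemma (the combinatorial step of the Lieb–Rivasseau inequality for plane rotors)

Topic `Literature/Probability/LatticeModels`. V. Rivasseau, *Lieb's correlation inequality for plane rotors*,
Comm. Math. Phys. 77 (1980) 145–147 [Rivasseau1980], Lemma (p. 146) — the conjecture of E. H. Lieb,
*A refinement of Simon's correlation inequality*, Comm. Math. Phys. 77 (1980) 127–135 [Lieb1980], p. 133, in the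
slightly stronger form proved by Rivasseau:

> Let `G` be a finite directed graph (possibly with several edges between two vertices) and let the valence at
> vertex `M_i` (the number of arrows in minus the number out) be `m_i`. Suppose `m_1 > 0`. Let `N(G)` be the set of
> subgraphs (subsets of edges, including the empty one) with valence `0` at every vertex, and `K(M_1, G)` the set of
> subgraphs with valence `+1` at `M_1`, valence `−1` at some vertex of negative total valence, and `0` elsewhere.
> Then `|N(G)| ≤ |K(M_1, G)|`.

(In the source the vertices of negative valence are listed as `M_2, …, M_k`; no hypothesis is needed on the other
vertices.) This is the hypothesis H.A1 of Lieb's Theorem 1 for the plane-rotor model after the double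
current expansion of the two sides of Lieb's (24) (Lieb 1980, p. 133: "if it were true would immediately yield a
proof of (10)"), hence the combinatorial content of the Lieb–Rivasseau separating inequality (the tree's named
fact `PlaneRotator.LiebRivasseauInequality`, `PlaneRotatorLiebRivasseauInequality.lean`). The analytic half
(current expansion + Lieb's gluing Lemma 1) is not in this file.

Formalisation: a directed multigraph is a finite set of edges `G : Finset E` with head and tail maps
`hd tl : E → V` (an arrow `e` goes OUT of `tl e` INTO `hd e`; no loops: `hd e ≠ tl e`); the valence of a subgraph
`S` at `v` is `val hd tl S v = #{e ∈ S : hd e = v} − #{e ∈ S : tl e = v}`.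

* `Rivasseau.val`, `Rivasseau.zeroSubgraphs` (`N(G)`), `Rivasseau.pathSubgraphs` (`K(v₁, G)`);
* `Rivasseau.card_zeroSubgraphs_le` — **the lemma**: `0 < val G v₁ ⇒ #N(G) ≤ #K(v₁, G)`.

Proof (Rivasseau's, p. 146–147): strong induction on the number of edges. For an arrow `l` INTO `v₁` from `v`:
`#{S ∈ N : l ∉ S} ≤ #{S ∈ K : l ∈ S}` — by the injection `S ↦ S ∪ {l}` if `m_v < 0`, and otherwise by the
induction hypothesis for `G − l` with distinguished vertex `v` (there `m_v + 1 > 0`), transported back by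
`S ↦ S ∪ {l}`. For an arrow `l` OUT of `v₁`: `#{S ∈ N : l ∈ S} ≤ #{S ∈ K : l ∉ S}` — if some `L ∈ N` contains `l`,
reversing the arrows of `L` preserves all valences of `G`, and `S ↦ S ∆ L` carries `N`, `K` to those of the reversed
graph while exchanging `l ∈ S` with `l ∉ S`; in the reversed graph `l` points INTO `v₁`. Finally every `S ∈ N`
lies in exactly `p` of the sets on the left and every `S ∈ K` in exactly `q + 1` of the sets on the right
(`p`/`q` = in/out-degree of `v₁`), and `q + 1 ≤ p` is `m_1 > 0`.
-/

namespace Literature.Probability.LatticeModels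

namespace Rivasseau

open Finset

variable {V E : Type*} [DecidableEq V] [DecidableEq E]

/-- The **valence** of a subgraph `S` (a set of arrows) at a vertex `v`: arrows of `S` into `v` minus arrows of
`S` out of `v` (Rivasseau 1980, Lemma: "the number of arrows in minus the number out"). [cite: Rivasseau1980, Lemma (p. 146)] -/
def val (hd tl : E → V) (S : Finset E) (v : V) : ℤ :=
  ((S.filter fun e => hd e = v).card : ℤ) - ((S.filter fun e => tl e = v).card : ℤ)

variable [Fintype V]

/-- `N(G)`: the subgraphs of `G` (subsets of edges, including the empty graph) with valence `0` at every vertex.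
[cite: Rivasseau1980, Lemma (p. 146)] -/
def zeroSubgraphs (hd tl : E → V) (G : Finset E) : Finset (Finset E) :=
  G.powerset.filter fun S => ∀ v, val hd tl S v = 0

/-- `K(v₁, G)`: the subgraphs of `G` with valence `+1` at `v₁`, valence `−1` at some vertex of negative total
valence (one of Rivasseau's `M_2, …, M_k`), and valence `0` at every other vertex. [cite: Rivasseau1980, Lemma (p. 146)] -/
def pathSubgraphs (hd tl : E → V) (G : Finset E) (v₁ : V) : Finset (Finset E) :=
  G.powerset.filter fun S => val hd tl S v₁ = 1 ∧
    ∃ w, val hd tl G w < 0 ∧ val hd tl S w = -1 ∧ ∀ u, u ≠ v₁ → u ≠ w → val hd tl S u = 0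

omit [Fintype V] in
/-- Valence is additive under inserting a new arrow: `val (insert e S) = val S + δ_{hd e} − δ_{tl e}`. [folklore] -/
private theorem val_insert (hd tl : E → V) {S : Finset E} {e : E} (he : e ∉ S) (v : V) :
    val hd tl (insert e S) v = val hd tl S v + (if hd e = v then 1 else 0) - (if tl e = v then 1 else 0) := by
  unfold val
  rw [filter_insert, filter_insert]
  by_cases h1 : hd e = v <;> by_cases h2 : tl e = v <;>
    simp [h1, h2, card_insert_of_notMem, mem_filter, he]
  <;> ring

omit [Fintype V] in
/-- Valence of a disjoint union. [folklore] -/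
private theorem val_union (hd tl : E → V) {S T : Finset E} (h : Disjoint S T) (v : V) :
    val hd tl (S ∪ T) v = val hd tl S v + val hd tl T v := by
  unfold val
  rw [filter_union, filter_union, card_union_of_disjoint (disjoint_filter_filter h),
    card_union_of_disjoint (disjoint_filter_filter h)]
  push_cast
  ring

omit [Fintype V] in
/-- Valence for a subgraph of `G` at `v`, in terms of the in- and out-stars of `v` in `G`. [folklore] -/
private theorem val_eq_card_inter (hd tl : E → V) {G S : Finset E} (hS : S ⊆ G) (v : V) :
    val hd tl S v = ((G.filter fun e => hd e = v) ∩ S).card - ((G.filter fun e => tl e = v) ∩ S).card := by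
  unfold val
  congr 2
  · congr 1; ext e; simp only [mem_filter, mem_inter]; constructor
    · rintro ⟨h1, h2⟩; exact ⟨⟨hS h1, h2⟩, h1⟩
    · rintro ⟨⟨_, h2⟩, h1⟩; exact ⟨h1, h2⟩
  · congr 1; ext e; simp only [mem_filter, mem_inter]; constructor
    · rintro ⟨h1, h2⟩; exact ⟨⟨hS h1, h2⟩, h1⟩
    · rintro ⟨⟨_, h2⟩, h1⟩; exact ⟨h1, h2⟩

/-! ### Reversal of a valence-free subgraph -/

omit [Fintype V] in
/-- Reversing the arrows of `L`: the valence of `T` in the reversed graph is `val (T ∖ L) − val (T ∩ L)`. [folklore] -/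
private theorem val_reverse (hd tl : E → V) (L T : Finset E) (v : V) :
    val (fun e => if e ∈ L then tl e else hd e) (fun e => if e ∈ L then hd e else tl e) T v =
      val hd tl (T \ L) v - val hd tl (T ∩ L) v := by
  unfold val
  have h1 : (T.filter fun e => (if e ∈ L then tl e else hd e) = v) =
      (T \ L).filter (fun e => hd e = v) ∪ (T ∩ L).filter (fun e => tl e = v) := by
    ext e; simp only [mem_filter, mem_union, mem_sdiff, mem_inter]
    by_cases h : e ∈ L <;> simp [h]
  have h2 : (T.filter fun e => (if e ∈ L then hd e else tl e) = v) =
      (T \ L).filter (fun e => tl e = v) ∪ (T ∩ L).filter (fun e => hd e = v) := by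
    ext e; simp only [mem_filter, mem_union, mem_sdiff, mem_inter]
    by_cases h : e ∈ L <;> simp [h]
  have hdisj : Disjoint (T \ L) (T ∩ L) :=
    disjoint_left.2 fun e he he' => (mem_sdiff.1 he).2 (mem_inter.1 he').2
  rw [h1, h2, card_union_of_disjoint (disjoint_filter_filter hdisj),
    card_union_of_disjoint (disjoint_filter_filter hdisj)]
  push_cast
  ring

omit [Fintype V] in
/-- If `L` has valence `0` everywhere, the symmetric difference with `L` transports valences from `G` to the
graph with the arrows of `L` reversed: `val' (S ∆ L) = val S`. [cite: Rivasseau1980, proof of the Lemma (reversal of a subgraph L ∈ N(G))] -/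
private theorem val_reverse_symmDiff (hd tl : E → V) {L : Finset E} (hL : ∀ v, val hd tl L v = 0) (S : Finset E)
    (v : V) :
    val (fun e => if e ∈ L then tl e else hd e) (fun e => if e ∈ L then hd e else tl e) (symmDiff S L) v =
      val hd tl S v := by
  rw [val_reverse]
  have e1 : symmDiff S L \ L = S \ L := by
    ext e; simp only [mem_sdiff, mem_symmDiff]; tauto
  have e2 : symmDiff S L ∩ L = L \ S := by
    ext e; simp only [mem_inter, mem_symmDiff, mem_sdiff]; tauto
  rw [e1, e2]
  have hS : val hd tl S v = val hd tl (S \ L) v + val hd tl (S ∩ L) v := by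
    rw [← val_union hd tl (disjoint_sdiff_inter S L), sdiff_union_inter]
  have hLv : val hd tl L v = val hd tl (L \ S) v + val hd tl (S ∩ L) v := by
    rw [← val_union hd tl, ← inter_comm, sdiff_union_inter]
    exact disjoint_left.2 fun e he he' => (mem_sdiff.1 he).2 (mem_inter.1 he').1
  rw [hS]
  linarith [hL v]

/-! ### The lemma -/

/-- **Rivasseau's lemma** (Lieb's digraph conjecture). For a finite directed multigraph `G` without loops and a
vertex `v₁` of positive valence, the number of valence-free subgraphs is at most the number of subgraphs with
valence `+1` at `v₁`, `−1` at some vertex of negative valence and `0` elsewhere: `|N(G)| ≤ |K(v₁, G)|`.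
[cite: Rivasseau1980, Lemma (p. 146)] -/
theorem card_zeroSubgraphs_le (hd tl : E → V) (hloop : ∀ e, hd e ≠ tl e) (G : Finset E) (v₁ : V)
    (h1 : 0 < val hd tl G v₁) : (zeroSubgraphs hd tl G).card ≤ (pathSubgraphs hd tl G v₁).card := by
  -- strong induction on the number of edges, for all head/tail maps and distinguished vertices
  suffices H : ∀ (n : ℕ) (hd tl : E → V), (∀ e, hd e ≠ tl e) → ∀ (G : Finset E) (v₁ : V), G.card = n →
      0 < val hd tl G v₁ → (zeroSubgraphs hd tl G).card ≤ (pathSubgraphs hd tl G v₁).card from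
    H _ hd tl hloop G v₁ rfl h1
  intro n
  induction n using Nat.strong_induction_on with
  | _ n ih =>
  intro hd tl hloop G v₁ hcard h1
  -- (5), first kind: for every graph on `G` (any head/tail maps) and every arrow `l` INTO the
  -- distinguished vertex, `#{S ∈ N : l ∉ S} ≤ #{S ∈ K : l ∈ S}`
  have claimIn : ∀ (hd tl : E → V), (∀ e, hd e ≠ tl e) → ∀ (v₁ : V), 0 < val hd tl G v₁ → ∀ l ∈ G, hd l = v₁ →
      ((zeroSubgraphs hd tl G).filter fun S => l ∉ S).card ≤
        ((pathSubgraphs hd tl G v₁).filter fun S => l ∈ S).card := by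
    intro hd tl hloop v₁ h1 l hl hlv
    set v := tl l with hv
    have hvne : v ≠ v₁ := fun h => hloop l (hlv.trans (hv ▸ h).symm)
    by_cases hmv : val hd tl G v < 0
    · -- injection `S ↦ insert l S`
      refine card_le_card_of_injOn (fun S => insert l S) (fun S hS => ?_) (fun S hS T hT hST => ?_)
      · rw [mem_coe, mem_filter] at hS
        obtain ⟨hS, hlS⟩ := hS
        rw [zeroSubgraphs, mem_filter, mem_powerset] at hS
        rw [mem_coe, mem_filter, pathSubgraphs, mem_filter, mem_powerset]
        refine ⟨⟨insert_subset hl hS.1, ?_, ⟨v, hmv, ?_, fun u hu1 huv => ?_⟩⟩, mem_insert_self l S⟩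
        · rw [val_insert hd tl hlS, hS.2 v₁, if_pos hlv, if_neg (fun h => hvne (hv.trans h))]; ring
        · rw [val_insert hd tl hlS, hS.2 v, if_neg (fun h => hvne (h.symm.trans hlv)), if_pos hv.symm]; ring
        · rw [val_insert hd tl hlS, hS.2 u, if_neg (fun h => hu1 (h.symm.trans hlv)),
            if_neg (fun h => huv (h.symm.trans hv.symm))]; ring
      · have hlS : l ∉ S := (mem_filter.1 (mem_coe.1 hS)).2
        have hlT : l ∉ T := (mem_filter.1 (mem_coe.1 hT)).2
        have := congrArg (fun X => Finset.erase X l) hST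
        simpa only [erase_insert hlS, erase_insert hlT] using this
    · -- induction hypothesis for `G.erase l` with distinguished vertex `v`
      push Not at hmv
      set G' := G.erase l with hG'
      have hcard' : G'.card < n := by
        have hpos := card_pos.2 ⟨l, hl⟩
        rw [hG', card_erase_of_mem hl]; omega
      have hGsplit : G = insert l G' := by rw [hG', insert_erase hl]
      have hlG' : l ∉ G' := by rw [hG']; exact notMem_erase l G
      have hvalG : ∀ u, val hd tl G u = val hd tl G' u + (if hd l = u then 1 else 0) - (if tl l = u then 1 else 0) :=
        fun u => by rw [hGsplit, val_insert hd tl hlG']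
      have h1' : 0 < val hd tl G' v := by
        have := hvalG v
        rw [if_neg (fun h => hvne (h.symm.trans hlv)), if_pos hv.symm] at this
        linarith
      have hIH := ih G'.card hcard' hd tl hloop G' v rfl h1'
      -- `{S ∈ N(G) : l ∉ S} = N(G')`
      have hN : ((zeroSubgraphs hd tl G).filter fun S => l ∉ S) = zeroSubgraphs hd tl G' := by
        ext S
        simp only [zeroSubgraphs, mem_filter, mem_powerset, hG', subset_erase]
        tauto
      rw [hN]
      refine hIH.trans (card_le_card_of_injOn (fun S => insert l S) (fun S hS => ?_) (fun S hS T hT hST => ?_))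
      · rw [mem_coe, pathSubgraphs, mem_filter, mem_powerset] at hS
        obtain ⟨hSG', hSv, w, hw, hSw, hSu⟩ := hS
        have hlS : l ∉ S := fun h => hlG' (hSG' h)
        have hwv : w ≠ v := by intro h; rw [h] at hSw; linarith
        have hw1 : w ≠ v₁ := by
          intro h
          rw [h] at hw
          have := hvalG v₁
          rw [if_pos hlv, if_neg (fun h' => hvne (hv.trans h'))] at this
          linarith
        have hwG : val hd tl G w < 0 := by
          rw [hvalG w, if_neg (fun h => hw1 (h.symm.trans hlv)), if_neg (fun h => hwv (h.symm.trans hv.symm))]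
          simpa using hw
        rw [mem_coe, mem_filter, pathSubgraphs, mem_filter, mem_powerset]
        refine ⟨⟨insert_subset hl (hSG'.trans (erase_subset l G)), ?_, ⟨w, hwG, ?_, fun u hu1 huw => ?_⟩⟩,
          mem_insert_self l S⟩
        · rw [val_insert hd tl hlS, if_pos hlv, if_neg (fun h => hvne (hv.trans h)), hSu v₁ hvne.symm hw1.symm]; ring
        · rw [val_insert hd tl hlS, hSw, if_neg (fun h => hw1 (h.symm.trans hlv)),
            if_neg (fun h => hwv (h.symm.trans hv.symm))]; ring
        · by_cases huv : u = v
          · subst huv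
            rw [val_insert hd tl hlS, hSv, if_neg (fun h => hu1 (h.symm.trans hlv)), if_pos hv.symm]; ring
          · rw [val_insert hd tl hlS, hSu u huv huw, if_neg (fun h => hu1 (h.symm.trans hlv)),
              if_neg (fun h => huv (h.symm.trans hv.symm))]; ring
      · have hlS : l ∉ S := fun h => hlG' ((mem_powerset.1 (mem_filter.1 (mem_coe.1 hS)).1) h)
        have hlT : l ∉ T := fun h => hlG' ((mem_powerset.1 (mem_filter.1 (mem_coe.1 hT)).1) h)
        have := congrArg (fun X => Finset.erase X l) hST
        simpa only [erase_insert hlS, erase_insert hlT] using this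
  -- (5), second kind: for an arrow `l` OUT of `v₁`, `#{S ∈ N : l ∈ S} ≤ #{S ∈ K : l ∉ S}` (reversal)
  have claimOut : ∀ l ∈ G, tl l = v₁ →
      ((zeroSubgraphs hd tl G).filter fun S => l ∈ S).card ≤
        ((pathSubgraphs hd tl G v₁).filter fun S => l ∉ S).card := by
    intro l hl hlv
    by_cases hempty : ((zeroSubgraphs hd tl G).filter fun S => l ∈ S) = ∅
    · rw [hempty, card_empty]; exact Nat.zero_le _
    obtain ⟨L, hL⟩ := nonempty_iff_ne_empty.2 hempty
    rw [mem_filter, zeroSubgraphs, mem_filter, mem_powerset] at hL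
    obtain ⟨⟨hLG, hL0⟩, hlL⟩ := hL
    -- the reversed graph
    set hd' : E → V := fun e => if e ∈ L then tl e else hd e with hhd'
    set tl' : E → V := fun e => if e ∈ L then hd e else tl e with htl'
    have hloop' : ∀ e, hd' e ≠ tl' e := fun e => by
      simp only [hhd', htl']; split_ifs; exacts [(hloop e).symm, hloop e]
    have hval' : ∀ S v, val hd' tl' (symmDiff S L) v = val hd tl S v := val_reverse_symmDiff hd tl hL0
    have hvalG' : ∀ v, val hd' tl' G v = val hd tl G v := by
      intro v
      have h1 : val hd' tl' G v = val hd tl (G \ L) v - val hd tl (G ∩ L) v := val_reverse hd tl L G v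
      have h2 : val hd tl G v = val hd tl (G \ L) v + val hd tl L v := by
        rw [← val_union hd tl disjoint_sdiff_self_left, sdiff_union_of_subset hLG]
      rw [h1, h2, inter_eq_right.2 hLG, hL0 v]; ring
    have h1' : 0 < val hd' tl' G v₁ := by rw [hvalG']; exact h1
    have hlv' : hd' l = v₁ := by simp only [hhd', if_pos hlL]; exact hlv
    -- `Φ S = S ∆ L` is an injection exchanging `l ∈ S` and `l ∉ S` and transporting `N`, `K`
    have hΦinj : ∀ (A : Finset (Finset E)), Set.InjOn (fun S => symmDiff S L) (A : Set (Finset E)) :=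
      fun A S _ T _ hST => symmDiff_left_injective L hST
    have hΦsub : ∀ S, S ⊆ G → symmDiff S L ⊆ G := fun S hS e he => by
      rcases (mem_symmDiff.1 he) with ⟨h, _⟩ | ⟨h, _⟩
      exacts [hS h, hLG h]
    have hΦl : ∀ S, (l ∈ symmDiff S L ↔ l ∉ S) := fun S => by
      rw [mem_symmDiff]; tauto
    have hvalΦ : ∀ S v, val hd tl (symmDiff S L) v = val hd' tl' S v := fun S v => by
      have := hval' (symmDiff S L) v
      rw [symmDiff_symmDiff_cancel_right] at this
      exact this.symm
    calc ((zeroSubgraphs hd tl G).filter fun S => l ∈ S).card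
        ≤ ((zeroSubgraphs hd' tl' G).filter fun S => l ∉ S).card := by
          refine card_le_card_of_injOn (fun S => symmDiff S L) (fun S hS => ?_) (hΦinj _)
          rw [mem_coe, mem_filter, zeroSubgraphs, mem_filter, mem_powerset] at hS
          rw [mem_coe, mem_filter, zeroSubgraphs, mem_filter, mem_powerset]
          exact ⟨⟨hΦsub S hS.1.1, fun v => by rw [hval', hS.1.2 v]⟩, fun h => (hΦl S).1 h hS.2⟩
      _ ≤ ((pathSubgraphs hd' tl' G v₁).filter fun S => l ∈ S).card := claimIn hd' tl' hloop' v₁ h1' l hl hlv'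
      _ ≤ ((pathSubgraphs hd tl G v₁).filter fun S => l ∉ S).card := by
          refine card_le_card_of_injOn (fun S => symmDiff S L) (fun S hS => ?_) (hΦinj _)
          rw [mem_coe, mem_filter, pathSubgraphs, mem_filter, mem_powerset] at hS
          obtain ⟨⟨hSG, hSv, w, hw, hSw, hSu⟩, hlS⟩ := hS
          rw [mem_coe, mem_filter, pathSubgraphs, mem_filter, mem_powerset]
          refine ⟨⟨hΦsub S hSG, by rw [hvalΦ, hSv], ⟨w, by rw [← hvalG']; exact hw, by rw [hvalΦ, hSw],
            fun u hu1 huw => by rw [hvalΦ, hSu u hu1 huw]⟩⟩, fun h => ?_⟩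
          exact absurd ((hΦl S).1 h) (not_not.2 hlS)
  -- double counting: every `S ∈ N` misses/contains exactly `p` of the arrows at `v₁` in the sense of the two
  -- claims, every `S ∈ K` exactly `q + 1`
  set N := zeroSubgraphs hd tl G with hN
  set K := pathSubgraphs hd tl G v₁ with hK
  set In := G.filter (fun e => hd e = v₁) with hIn
  set Out := G.filter (fun e => tl e = v₁) with hOut
  have hpq : ((In.card : ℤ)) - Out.card = val hd tl G v₁ := rfl
  have hp : Out.card + 1 ≤ In.card := by
    have := h1; rw [← hpq] at this; omega
  have hNsub : ∀ S ∈ N, S ⊆ G := fun S hS => mem_powerset.1 (mem_filter.1 hS).1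
  have hKsub : ∀ S ∈ K, S ⊆ G := fun S hS => mem_powerset.1 (mem_filter.1 hS).1
  -- per-subgraph counts
  have hcountN : ∀ S ∈ N, (In \ S).card + (Out ∩ S).card = In.card := by
    intro S hS
    have h0 : ((In ∩ S).card : ℤ) - (Out ∩ S).card = 0 := by
      rw [hIn, hOut, ← val_eq_card_inter hd tl (hNsub S hS) v₁]
      exact (mem_filter.1 hS).2 v₁
    have := card_sdiff_add_card_inter In S
    omega
  have hcountK : ∀ S ∈ K, (In ∩ S).card + (Out \ S).card = Out.card + 1 := by
    intro S hS
    have hS1 : ((In ∩ S).card : ℤ) - (Out ∩ S).card = 1 := by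
      rw [hIn, hOut, ← val_eq_card_inter hd tl (hKsub S hS) v₁]
      exact (mem_filter.1 hS).2.1
    have := card_sdiff_add_card_inter Out S
    omega
  -- rewrite the sums over arrows as sums over subgraphs
  have hswap : ∀ (A : Finset (Finset E)) (B : Finset E) (P : E → Finset E → Prop) [∀ l S, Decidable (P l S)],
      ∑ l ∈ B, (A.filter fun S => P l S).card = ∑ S ∈ A, (B.filter fun l => P l S).card := by
    intro A B P _
    simp_rw [card_filter]
    exact Finset.sum_comm
  have hLHS : ∑ l ∈ In, (N.filter fun S => l ∉ S).card + ∑ l ∈ Out, (N.filter fun S => l ∈ S).card =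
      In.card * N.card := by
    rw [hswap N In (fun l S => l ∉ S), hswap N Out (fun l S => l ∈ S), ← sum_add_distrib]
    rw [show In.card * N.card = ∑ S ∈ N, In.card by rw [sum_const, smul_eq_mul, mul_comm]]
    refine sum_congr rfl fun S hS => ?_
    rw [← hcountN S hS, sdiff_eq_filter, filter_mem_eq_inter]
  have hRHS : ∑ l ∈ In, (K.filter fun S => l ∈ S).card + ∑ l ∈ Out, (K.filter fun S => l ∉ S).card =
      (Out.card + 1) * K.card := by
    rw [hswap K In (fun l S => l ∈ S), hswap K Out (fun l S => l ∉ S), ← sum_add_distrib]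
    rw [show (Out.card + 1) * K.card = ∑ S ∈ K, (Out.card + 1) by rw [sum_const, smul_eq_mul, mul_comm]]
    refine sum_congr rfl fun S hS => ?_
    rw [← hcountK S hS, sdiff_eq_filter, filter_mem_eq_inter]
  have hle : In.card * N.card ≤ (Out.card + 1) * K.card := by
    rw [← hLHS, ← hRHS]
    refine Nat.add_le_add (sum_le_sum fun l hl => ?_) (sum_le_sum fun l hl => ?_)
    · exact claimIn hd tl hloop v₁ h1 l (mem_filter.1 hl).1 (mem_filter.1 hl).2
    · exact claimOut l (mem_filter.1 hl).1 (mem_filter.1 hl).2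
  have hle' : In.card * N.card ≤ In.card * K.card := hle.trans (Nat.mul_le_mul_right _ hp)
  exact Nat.le_of_mul_le_mul_left hle' (by omega)

/-! ### Multiplicity form: arrows with multiplicities on finitely many slots

For the analytic half of the Lieb–Rivasseau inequality (the double current expansion of the plane-rotator
weights `e^{J cos(θ_y − θ_x)} = ∑_{p,q} (J/2)^{p+q}/(p! q!) (θ̄_xθ_y)^p (θ_xθ̄_y)^q`) the lemma is consumed in the
following form: each SLOT `a ∈ ι` (an ordered pair with head `hd a` and tail `tl a`) carries `T a` distinguishable
arrows; a subgraph with `n a` arrows in slot `a` has valence `mval n`, and there are `∏_a C(T a, n a)` of them. -/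

section Multiplicity

variable {ι : Type*} [Fintype ι] [DecidableEq ι]

/-- The valence of a multiplicity vector `n : ι → ℕ` on slots with heads `hd` and tails `tl`:
`∑_{a : hd a = v} n a − ∑_{a : tl a = v} n a`. [cite: Rivasseau1980, Lemma (p. 146)] -/
def mval (hd tl : ι → V) (n : ι → ℕ) (v : V) : ℤ :=
  (∑ a ∈ univ.filter (fun a => hd a = v), (n a : ℤ)) - ∑ a ∈ univ.filter (fun a => tl a = v), (n a : ℤ)

/-- The box of sub-multiplicities `0 ≤ n ≤ T`. [folklore] -/
def subMult (T : ι → ℕ) : Finset (ι → ℕ) :=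
  Fintype.piFinset fun a => range (T a + 1)

/-- The arrows of a multiplicity vector `T`: `T a` distinguishable arrows in slot `a`. [folklore] -/
abbrev Arrow (T : ι → ℕ) : Type _ := Σ a : ι, Fin (T a)

variable {T : ι → ℕ}

/-- The arrows of `S` in slot `a`. [folklore] -/
noncomputable def slotSec (S : Finset (Arrow T)) (a : ι) : Finset (Fin (T a)) :=
  Finset.preimage S (Sigma.mk (β := fun b => Fin (T b)) a) sigma_mk_injective.injOn

/-- The slot counts of a set of arrows. [folklore] -/
noncomputable def counts (S : Finset (Arrow T)) : ι → ℕ := fun a => (slotSec S a).card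

omit [Fintype V] in
/-- The valence of a set of arrows is the valence of its slot counts. [folklore] -/
private theorem val_arrow_eq_mval (hd tl : ι → V) (S : Finset (Arrow T)) (v : V) :
    val (fun e : Arrow T => hd e.1) (fun e => tl e.1) S v = mval hd tl (counts S) v := by
  unfold val mval counts slotSec
  have key : ∀ (f : ι → V), ((S.filter fun e : Arrow T => f e.1 = v).card : ℤ) =
      ∑ a ∈ univ.filter (fun a => f a = v), ((S.preimage (Sigma.mk a) sigma_mk_injective.injOn).card : ℤ) := by
    intro f
    rw [← Nat.cast_sum, ← card_sigma, sigma_preimage_mk]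
    congr 2
    ext e
    simp only [mem_filter, mem_univ, true_and]
  rw [key hd, key tl]

/-- Slot counts lie in the box `0 ≤ n ≤ T`. [folklore] -/
private theorem counts_mem_subMult (S : Finset (Arrow T)) : counts S ∈ subMult T := by
  rw [subMult, Fintype.mem_piFinset]
  intro a
  rw [mem_range, Nat.lt_succ_iff, counts]
  calc (slotSec S a).card ≤ (univ : Finset (Fin (T a))).card := card_le_card (subset_univ _)
    _ = T a := by rw [card_univ, Fintype.card_fin]

/-- **Counting**: the number of arrow sets with prescribed slot counts `n` is `∏_a C(T a, n a)`. [folklore] -/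
private theorem card_filter_counts_eq (n : ι → ℕ) :
    ((univ : Finset (Finset (Arrow T))).filter fun S => counts S = n).card = ∏ a, (T a).choose (n a) := by
  -- bijection with `Π a, {s ⊆ Fin (T a) : #s = n a}`
  rw [show (∏ a, (T a).choose (n a)) = (Fintype.piFinset fun a => powersetCard (n a) (univ : Finset (Fin (T a)))).card
    by rw [Fintype.card_piFinset]; simp [card_powersetCard]]
  have hrecon : ∀ S : Finset (Arrow T), univ.sigma (slotSec S) = S := fun S =>
    sigma_preimage_mk_of_subset S (subset_univ _)
  refine card_bij (fun S _ => slotSec S) (fun S hS => ?_) (fun S hS S' hS' h => ?_) (fun t ht => ?_)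
  · rw [mem_filter] at hS
    rw [Fintype.mem_piFinset]
    intro a
    rw [mem_powersetCard]
    exact ⟨subset_univ _, by rw [← hS.2]; rfl⟩
  · rw [← hrecon S, ← hrecon S', h]
  · refine ⟨univ.sigma t, ?_, ?_⟩
    · rw [mem_filter]
      refine ⟨mem_univ _, funext fun a => ?_⟩
      rw [Fintype.mem_piFinset] at ht
      have hta := (mem_powersetCard.1 (ht a)).2
      rw [counts, ← hta]
      congr 1
      ext i
      simp [slotSec]
    · funext a
      ext i
      simp [slotSec]

/-- **Rivasseau's lemma, multiplicity form.** Slots `a ∈ ι` with heads `hd a ≠ tl a` and multiplicities `T a`;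
if the valence of `T` at `v₁` is positive, then
`∑_{n ≤ T, mval n = 0} ∏_a C(T a, n a) ≤ ∑_{n ≤ T, mval n = δ_{v₁} − δ_w for some w with mval T w < 0} ∏_a C(T a, n a)`
— the form in which the double current expansion of the plane-rotator two-point functions consumes the lemma
(each sub-multiplicity `n ≤ T` is realised by `∏ C(T a, n a)` sets of distinguishable arrows).
[cite: Rivasseau1980, Lemma (p. 146)] -/
theorem sum_choose_mval_zero_le (hd tl : ι → V) (hloop : ∀ a, hd a ≠ tl a) (T : ι → ℕ) (v₁ : V)
    (h1 : 0 < mval hd tl T v₁) :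
    ∑ n ∈ (subMult T).filter (fun n => ∀ v, mval hd tl n v = 0), ∏ a, (T a).choose (n a) ≤
      ∑ n ∈ (subMult T).filter (fun n => mval hd tl n v₁ = 1 ∧
          ∃ w, mval hd tl T w < 0 ∧ mval hd tl n w = -1 ∧ ∀ u, u ≠ v₁ → u ≠ w → mval hd tl n u = 0),
        ∏ a, (T a).choose (n a) := by
  -- the digraph of distinguishable arrows
  set hd' : Arrow T → V := fun e => hd e.1 with hhd'
  set tl' : Arrow T → V := fun e => tl e.1 with htl'
  have hloop' : ∀ e, hd' e ≠ tl' e := fun e => hloop e.1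
  have hvalS : ∀ S v, val hd' tl' S v = mval hd tl (counts S) v := val_arrow_eq_mval hd tl
  have hcountsU : counts (univ : Finset (Arrow T)) = T := by
    funext a
    rw [counts]
    have : slotSec (univ : Finset (Arrow T)) a = univ := by
      ext i; simp [slotSec]
    rw [this, card_univ, Fintype.card_fin]
  have hvalU : ∀ v, val hd' tl' univ v = mval hd tl T v := fun v => by rw [hvalS, hcountsU]
  have h1' : 0 < val hd' tl' univ v₁ := by rw [hvalU]; exact h1
  have key := card_zeroSubgraphs_le hd' tl' hloop' univ v₁ h1'
  -- both sides as sums over slot counts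
  have hfib : ∀ (P : (ι → ℕ) → Prop) [DecidablePred P],
      ((univ : Finset (Arrow T)).powerset.filter fun S => P (counts S)).card =
        ∑ n ∈ (subMult T).filter P, ∏ a, (T a).choose (n a) := by
    intro P _
    rw [card_eq_sum_card_fiberwise (f := counts) (t := subMult T) (fun S _ => counts_mem_subMult S), sum_filter]
    refine sum_congr rfl fun n _ => ?_
    split_ifs with hP
    · rw [← card_filter_counts_eq n]
      congr 1
      ext S
      simp only [mem_filter, true_and, mem_univ, powerset_univ]
      constructor
      · rintro ⟨_, h⟩; exact h
      · intro h; exact ⟨h ▸ hP, h⟩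
    · rw [card_eq_zero, filter_eq_empty_iff]
      rintro S hS
      rw [mem_filter] at hS
      intro h
      exact hP (h ▸ hS.2)
  have hN : (zeroSubgraphs hd' tl' univ).card =
      ∑ n ∈ (subMult T).filter (fun n => ∀ v, mval hd tl n v = 0), ∏ a, (T a).choose (n a) := by
    rw [← hfib]
    congr 1
    ext S
    simp only [zeroSubgraphs, mem_filter, hvalS]
  have hK : (pathSubgraphs hd' tl' univ v₁).card =
      ∑ n ∈ (subMult T).filter (fun n => mval hd tl n v₁ = 1 ∧
          ∃ w, mval hd tl T w < 0 ∧ mval hd tl n w = -1 ∧ ∀ u, u ≠ v₁ → u ≠ w → mval hd tl n u = 0),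
        ∏ a, (T a).choose (n a) := by
    rw [← hfib]
    congr 1
    ext S
    simp only [pathSubgraphs, mem_filter, hvalS, hcountsU]
  rw [← hN, ← hK]
  exact key

/-- **Rivasseau's lemma, multiplicity form, loops allowed on EMPTY slots**: as `sum_choose_mval_zero_le`, but the
no-loop hypothesis `hd a ≠ tl a` is only required on slots carrying arrows (`T a ≠ 0`) — the form needed when the
slot set contains diagonal pairs with zero multiplicity. [cite: Rivasseau1980, Lemma (p. 146)] -/
theorem sum_choose_mval_zero_le' (hd tl : ι → V) (T : ι → ℕ) (hloop : ∀ a, T a ≠ 0 → hd a ≠ tl a) (v₁ : V)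
    (h1 : 0 < mval hd tl T v₁) :
    ∑ n ∈ (subMult T).filter (fun n => ∀ v, mval hd tl n v = 0), ∏ a, (T a).choose (n a) ≤
      ∑ n ∈ (subMult T).filter (fun n => mval hd tl n v₁ = 1 ∧
          ∃ w, mval hd tl T w < 0 ∧ mval hd tl n w = -1 ∧ ∀ u, u ≠ v₁ → u ≠ w → mval hd tl n u = 0),
        ∏ a, (T a).choose (n a) := by
  -- the digraph of distinguishable arrows has no loops: an arrow lives on a slot with `T a ≠ 0`
  set hd' : Arrow T → V := fun e => hd e.1 with hhd'
  set tl' : Arrow T → V := fun e => tl e.1 with htl'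
  have hloop' : ∀ e, hd' e ≠ tl' e := fun e => hloop e.1 (fun h => by
    have h2 : (e.2 : ℕ) < T e.1 := e.2.isLt
    omega)
  have hvalS : ∀ S v, val hd' tl' S v = mval hd tl (counts S) v := val_arrow_eq_mval hd tl
  have hcountsU : counts (univ : Finset (Arrow T)) = T := by
    funext a
    rw [counts]
    have : slotSec (univ : Finset (Arrow T)) a = univ := by
      ext i; simp [slotSec]
    rw [this, card_univ, Fintype.card_fin]
  have hvalU : ∀ v, val hd' tl' univ v = mval hd tl T v := fun v => by rw [hvalS, hcountsU]
  have h1' : 0 < val hd' tl' univ v₁ := by rw [hvalU]; exact h1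
  have key := card_zeroSubgraphs_le hd' tl' hloop' univ v₁ h1'
  have hfib : ∀ (P : (ι → ℕ) → Prop) [DecidablePred P],
      ((univ : Finset (Arrow T)).powerset.filter fun S => P (counts S)).card =
        ∑ n ∈ (subMult T).filter P, ∏ a, (T a).choose (n a) := by
    intro P _
    rw [card_eq_sum_card_fiberwise (f := counts) (t := subMult T) (fun S _ => counts_mem_subMult S), sum_filter]
    refine sum_congr rfl fun n _ => ?_
    split_ifs with hP
    · rw [← card_filter_counts_eq n]
      congr 1
      ext S
      simp only [mem_filter, true_and, mem_univ, powerset_univ]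
      constructor
      · rintro ⟨_, h⟩; exact h
      · intro h; exact ⟨h ▸ hP, h⟩
    · rw [card_eq_zero, filter_eq_empty_iff]
      rintro S hS
      rw [mem_filter] at hS
      intro h
      exact hP (h ▸ hS.2)
  have hN : (zeroSubgraphs hd' tl' univ).card =
      ∑ n ∈ (subMult T).filter (fun n => ∀ v, mval hd tl n v = 0), ∏ a, (T a).choose (n a) := by
    rw [← hfib]
    congr 1
    ext S
    simp only [zeroSubgraphs, mem_filter, hvalS]
  have hK : (pathSubgraphs hd' tl' univ v₁).card =
      ∑ n ∈ (subMult T).filter (fun n => mval hd tl n v₁ = 1 ∧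
          ∃ w, mval hd tl T w < 0 ∧ mval hd tl n w = -1 ∧ ∀ u, u ≠ v₁ → u ≠ w → mval hd tl n u = 0),
        ∏ a, (T a).choose (n a) := by
    rw [← hfib]
    congr 1
    ext S
    simp only [pathSubgraphs, mem_filter, hvalS, hcountsU]
  rw [← hN, ← hK]
  exact key

end Multiplicity

end Rivasseau

end Literature.Probability.LatticeModels
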